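import Mathlib
import Summits.QuantumFields.YangMills.Theorems.RationalShortRootRigidityStieltjesTransfer
import Summits.QuantumFields.YangMills.Theorems.RationalShortRootRigidityAlternationSimpleShells

/-!
# `RationalShortRootRigidity` — Step 4 (`stub_alternation`) assembly, part VII: the stub

ASSEMBLY of Step 4 of the paper proof of crux `stmt-QuantumFields-23124` (`F4SubCurvatureDoor.RationalShortRootRigidity`,
LINE g15-A of planner ym-idea-3).  The statement `stub_alternation` below is the Step-4 stub of the birth skeleton
HOME l15/RationalShortRootRigidity-birth.lean VERBATIM, with the skeleton's abbreviations `IsB4Inv`, `IsHalfInv`, `Radial`,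
`AxisStieltjes`, `RadialRatio` unfolded (exactly as in the landing of `stub_so4`, p660676):

**Theorem** (`stub_alternation`).  Let `N₀` be `W(B₄)`-invariant and invariant under the half-reflection, `D₀ ≠ 0` radial
(`D₀(p) = R(p²)`), `deg N₀ ≤ deg D₀ + 2`, and `N₀/D₀` axis-Stieltjes for every spatial momentum `q ≠ 0`.  Then `N₀/D₀` is a
radial ratio: `N₀(p)·G(p²) = D₀(p)·F(p²)` with `G ≠ 0`.

Proof (plan HOME l15/STUB-PLAN-Alternation.md, with the general radial denominator handled by PEELING).  Strong induction on
`deg R` (`radial_main`).  If `R` has a non-real root `z` or a multiple real root `ρ`, the local analysis (part IV) shows that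
`T = (X−z)(X−z̄)` resp. `X − ρ` divides every fibre `X ↦ E(X, q)` of the shell form `N₀(p) = E(p², q)` (part II), hence
`E = T(X)·E₁` (part V) and `R = T·R₁`; the pair `(E₁, R₁)` inherits the budget, the invariances (part V) and the axis-Stieltjes
structure (tree lemma `stieltjesTransfer`, p668794, full degree of `T(p²)` from part V), so induction applies.  Otherwise all
roots of `R` are real and simple (`simple_shell_radial`, part VI): they are the `k = deg R` shells, the local analysis gives the SHELL SIGNS
(ALT), the alternation core (part I) kills the `q`-components of `E` of degree `≥ 5`, and the quartic bottleneck (part III, tree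
lemma `quarticF4Radial`) makes `N₀` radial.  A radial `N₀ = F(p²)` over a radial `D₀ = R(p²)` is a radial ratio with `G = R`.

Mathlib + tree lemmas; THEOREMS ONLY; no named facts; no `sorry`; default heartbeats.  HONEST LABEL: this is Step 4 of 4 of the
paper proof of the OPEN crux 23124 (Steps 1–2 = `stub_reduce`, `stub_planar` remain; Step 3 = p660676); the crux, the route
`F4SubCurvatureDoor`, rung R2d and the Yang–Mills mass gap are NOT proved here.  Free-hands width seat `ym-line-sfw-p2-w4` g18,
`--supports stmt-QuantumFields-23124`.
-/

set_option autoImplicit false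

namespace Summit.QuantumFields.YangMills.Theorems.RationalShortRootRigidity.Alternation

open scoped BigOperators Polynomial ComplexConjugate

/-! ### 1. Peeling one radial factor -/

/-- **Peeling step**: a monic `T ≠ 1` dividing `R` and every fibre of `E` is a common radial factor; the quotient pair
inherits budget, invariances and the axis-Stieltjes structure. [folklore] -/
theorem peel (E : MvPolynomial (Fin 4) ℝ) (R T : ℝ[X]) (hR : R ≠ 0) (hT : T.Monic) (hT1 : T ≠ 1) (hTR : T ∣ R)
    (hTE : ∀ q : Fin 3 → ℝ, q ≠ 0 → T ∣ Polynomial.map (MvPolynomial.eval q) (MvPolynomial.finSuccEquiv ℝ 3 E))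
    (hdeg : (MvPolynomial.bind₁
      (fun i : Fin 4 => if i = 0 then ∑ j : Fin 4, (MvPolynomial.X j : MvPolynomial (Fin 4) ℝ) ^ 2
        else MvPolynomial.X i) E).totalDegree ≤ 2 * R.natDegree + 2)
    (hB4 : ∀ (σ : Equiv.Perm (Fin 4)) (ε : Fin 4 → ℝ), (∀ i, ε i = 1 ∨ ε i = -1) →
      ∀ p : Fin 4 → ℝ, MvPolynomial.eval (fun i => ε i * p (σ i)) (MvPolynomial.bind₁
        (fun i : Fin 4 => if i = 0 then ∑ j : Fin 4, (MvPolynomial.X j : MvPolynomial (Fin 4) ℝ) ^ 2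
          else MvPolynomial.X i) E) =
        MvPolynomial.eval p (MvPolynomial.bind₁
          (fun i : Fin 4 => if i = 0 then ∑ j : Fin 4, (MvPolynomial.X j : MvPolynomial (Fin 4) ℝ) ^ 2
            else MvPolynomial.X i) E))
    (hHalf : ∀ p : Fin 4 → ℝ, MvPolynomial.eval (fun i => p i - (∑ j, p j) / 2) (MvPolynomial.bind₁
        (fun i : Fin 4 => if i = 0 then ∑ j : Fin 4, (MvPolynomial.X j : MvPolynomial (Fin 4) ℝ) ^ 2
          else MvPolynomial.X i) E) =
        MvPolynomial.eval p (MvPolynomial.bind₁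
          (fun i : Fin 4 => if i = 0 then ∑ j : Fin 4, (MvPolynomial.X j : MvPolynomial (Fin 4) ℝ) ^ 2
            else MvPolynomial.X i) E))
    (hSt : ∀ q : Fin 3 → ℝ, q ≠ 0 → ∃ (k : ℕ) (ω r : Fin k → ℝ) (c : Polynomial ℝ),
      (∀ j, 0 < ω j) ∧ (∀ j, 0 ≤ r j) ∧
      ∀ t : ℝ, MvPolynomial.eval (Fin.cons t q) (MvPolynomial.bind₁
        (fun i : Fin 4 => if i = 0 then ∑ j : Fin 4, (MvPolynomial.X j : MvPolynomial (Fin 4) ℝ) ^ 2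
          else MvPolynomial.X i) E) =
        MvPolynomial.eval (Fin.cons t q)
          (Polynomial.aeval (∑ j : Fin 4, (MvPolynomial.X j : MvPolynomial (Fin 4) ℝ) ^ 2) R) *
          (c.eval (t ^ 2) + ∑ j, r j / (t ^ 2 + ω j ^ 2))) :
    ∃ (E₁ : MvPolynomial (Fin 4) ℝ) (R₁ : ℝ[X]), R₁ ≠ 0 ∧ R₁.natDegree + T.natDegree = R.natDegree ∧
      (MvPolynomial.bind₁
        (fun i : Fin 4 => if i = 0 then ∑ j : Fin 4, (MvPolynomial.X j : MvPolynomial (Fin 4) ℝ) ^ 2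
          else MvPolynomial.X i) E₁).totalDegree ≤ 2 * R₁.natDegree + 2 ∧
      (∀ (σ : Equiv.Perm (Fin 4)) (ε : Fin 4 → ℝ), (∀ i, ε i = 1 ∨ ε i = -1) →
        ∀ p : Fin 4 → ℝ, MvPolynomial.eval (fun i => ε i * p (σ i)) (MvPolynomial.bind₁
          (fun i : Fin 4 => if i = 0 then ∑ j : Fin 4, (MvPolynomial.X j : MvPolynomial (Fin 4) ℝ) ^ 2
            else MvPolynomial.X i) E₁) =
          MvPolynomial.eval p (MvPolynomial.bind₁
            (fun i : Fin 4 => if i = 0 then ∑ j : Fin 4, (MvPolynomial.X j : MvPolynomial (Fin 4) ℝ) ^ 2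
              else MvPolynomial.X i) E₁)) ∧
      (∀ p : Fin 4 → ℝ, MvPolynomial.eval (fun i => p i - (∑ j, p j) / 2) (MvPolynomial.bind₁
          (fun i : Fin 4 => if i = 0 then ∑ j : Fin 4, (MvPolynomial.X j : MvPolynomial (Fin 4) ℝ) ^ 2
            else MvPolynomial.X i) E₁) =
          MvPolynomial.eval p (MvPolynomial.bind₁
            (fun i : Fin 4 => if i = 0 then ∑ j : Fin 4, (MvPolynomial.X j : MvPolynomial (Fin 4) ℝ) ^ 2
              else MvPolynomial.X i) E₁)) ∧
      (∀ q : Fin 3 → ℝ, q ≠ 0 → ∃ (k : ℕ) (ω r : Fin k → ℝ) (c : Polynomial ℝ),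
        (∀ j, 0 < ω j) ∧ (∀ j, 0 ≤ r j) ∧
        ∀ t : ℝ, MvPolynomial.eval (Fin.cons t q) (MvPolynomial.bind₁
          (fun i : Fin 4 => if i = 0 then ∑ j : Fin 4, (MvPolynomial.X j : MvPolynomial (Fin 4) ℝ) ^ 2
            else MvPolynomial.X i) E₁) =
          MvPolynomial.eval (Fin.cons t q)
            (Polynomial.aeval (∑ j : Fin 4, (MvPolynomial.X j : MvPolynomial (Fin 4) ℝ) ^ 2) R₁) *
            (c.eval (t ^ 2) + ∑ j, r j / (t ^ 2 + ω j ^ 2))) ∧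
      (∀ p : Fin 4 → ℝ, MvPolynomial.eval p (MvPolynomial.bind₁
          (fun i : Fin 4 => if i = 0 then ∑ j : Fin 4, (MvPolynomial.X j : MvPolynomial (Fin 4) ℝ) ^ 2
            else MvPolynomial.X i) E) =
        T.eval (∑ i, p i ^ 2) * MvPolynomial.eval p (MvPolynomial.bind₁
          (fun i : Fin 4 => if i = 0 then ∑ j : Fin 4, (MvPolynomial.X j : MvPolynomial (Fin 4) ℝ) ^ 2
            else MvPolynomial.X i) E₁)) := by
  classical
  obtain ⟨R₁, hR₁⟩ := hTR
  obtain ⟨E₁, hE₁⟩ := exists_shellFactor T hT hT1 E hTE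
  have hTne : T ≠ 0 := hT.ne_zero
  have hR₁ne : R₁ ≠ 0 := by
    intro h
    apply hR
    rw [hR₁, h, mul_zero]
  -- notation-free names for the p-picture objects
  set S : MvPolynomial (Fin 4) ℝ := ∑ j : Fin 4, (MvPolynomial.X j : MvPolynomial (Fin 4) ℝ) ^ 2 with hS
  set H : MvPolynomial (Fin 4) ℝ := Polynomial.aeval S T with hH
  set N₁ : MvPolynomial (Fin 4) ℝ := MvPolynomial.bind₁
    (fun i : Fin 4 => if i = 0 then S else MvPolynomial.X i) E₁ with hN₁
  have hN : MvPolynomial.bind₁ (fun i : Fin 4 => if i = 0 then S else MvPolynomial.X i) E = H * N₁ := by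
    rw [hE₁, map_mul, hH, hS, shell_aeval_X0]
  have hD : Polynomial.aeval S R = Polynomial.aeval S R₁ * H := by
    rw [hR₁, map_mul, hH, mul_comm]
  have hHdeg := fullDeg_aeval_sumSq T hT
  have hevalH : ∀ p : Fin 4 → ℝ, MvPolynomial.eval p H = T.eval (∑ i, p i ^ 2) := fun p => by
    rw [hH, hS, eval_aeval_sumSq]
  refine ⟨E₁, R₁, hR₁ne, ?_, ?_, ?_, ?_, ?_, ?_⟩
  · -- degrees
    have h := congrArg Polynomial.natDegree hR₁
    rw [Polynomial.natDegree_mul hTne hR₁ne] at h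
    omega
  · -- budget
    show N₁.totalDegree ≤ 2 * R₁.natDegree + 2
    by_cases hN₁0 : N₁ = 0
    · rw [hN₁0, MvPolynomial.totalDegree_zero]
      exact Nat.zero_le _
    · have hHne : H ≠ 0 := aeval_sumSq_ne_zero T hTne
      have hmul := MvPolynomial.totalDegree_mul_of_isDomain hHne hN₁0
      rw [← hN, hHdeg.1] at hmul
      have h := congrArg Polynomial.natDegree hR₁
      rw [Polynomial.natDegree_mul hTne hR₁ne] at h
      omega
  · -- W(B₄)-invariance of the quotient
    intro σ ε hε
    refine invariant_of_mul_radial T hTne N₁ (fun p => fun i => ε i * p (σ i)) ?_ (sumSq_signedPerm σ ε hε) ?_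
    · exact continuous_pi fun i => continuous_const.mul (continuous_apply (σ i))
    · intro p
      rw [← hH, ← hN]
      exact hB4 σ ε hε p
  · -- half-reflection invariance of the quotient
    refine invariant_of_mul_radial T hTne N₁ (fun p => fun i => p i - (∑ j, p j) / 2) ?_ sumSq_half ?_
    · exact continuous_pi fun i => (continuous_apply i).sub
        ((continuous_finsetSum _ fun j _ => continuous_apply j).div_const _)
    · intro p
      rw [← hH, ← hN]
      exact hHalf p
  · -- axis-Stieltjes structure of the quotient (tree lemma `stieltjesTransfer`)
    have h := stieltjesTransfer (H * N₁) (Polynomial.aeval S R₁ * H) N₁ (Polynomial.aeval S R₁) H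
      (mul_comm _ _) rfl hHdeg.2 (by
        intro q hq
        obtain ⟨k, ω, r, c, hω, hr, hid⟩ := hSt q hq
        refine ⟨k, ω, r, c, hω, hr, fun t => ?_⟩
        rw [← hN, ← hD]
        exact hid t)
    exact h
  · intro p
    rw [hN, map_mul, hevalH]

/-! ### 2. The induction -/

/-- **Radiality by peeling** (strong induction on `deg R`). [folklore] -/
theorem radial_main : ∀ (n : ℕ) (E : MvPolynomial (Fin 4) ℝ) (R : ℝ[X]), R ≠ 0 → R.natDegree = n →
    (MvPolynomial.bind₁
      (fun i : Fin 4 => if i = 0 then ∑ j : Fin 4, (MvPolynomial.X j : MvPolynomial (Fin 4) ℝ) ^ 2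
        else MvPolynomial.X i) E).totalDegree ≤ 2 * R.natDegree + 2 →
    (∀ (σ : Equiv.Perm (Fin 4)) (ε : Fin 4 → ℝ), (∀ i, ε i = 1 ∨ ε i = -1) →
      ∀ p : Fin 4 → ℝ, MvPolynomial.eval (fun i => ε i * p (σ i)) (MvPolynomial.bind₁
        (fun i : Fin 4 => if i = 0 then ∑ j : Fin 4, (MvPolynomial.X j : MvPolynomial (Fin 4) ℝ) ^ 2
          else MvPolynomial.X i) E) =
        MvPolynomial.eval p (MvPolynomial.bind₁
          (fun i : Fin 4 => if i = 0 then ∑ j : Fin 4, (MvPolynomial.X j : MvPolynomial (Fin 4) ℝ) ^ 2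
            else MvPolynomial.X i) E)) →
    (∀ p : Fin 4 → ℝ, MvPolynomial.eval (fun i => p i - (∑ j, p j) / 2) (MvPolynomial.bind₁
        (fun i : Fin 4 => if i = 0 then ∑ j : Fin 4, (MvPolynomial.X j : MvPolynomial (Fin 4) ℝ) ^ 2
          else MvPolynomial.X i) E) =
        MvPolynomial.eval p (MvPolynomial.bind₁
          (fun i : Fin 4 => if i = 0 then ∑ j : Fin 4, (MvPolynomial.X j : MvPolynomial (Fin 4) ℝ) ^ 2
            else MvPolynomial.X i) E)) →
    (∀ q : Fin 3 → ℝ, q ≠ 0 → ∃ (k : ℕ) (ω r : Fin k → ℝ) (c : Polynomial ℝ),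
      (∀ j, 0 < ω j) ∧ (∀ j, 0 ≤ r j) ∧
      ∀ t : ℝ, MvPolynomial.eval (Fin.cons t q) (MvPolynomial.bind₁
        (fun i : Fin 4 => if i = 0 then ∑ j : Fin 4, (MvPolynomial.X j : MvPolynomial (Fin 4) ℝ) ^ 2
          else MvPolynomial.X i) E) =
        MvPolynomial.eval (Fin.cons t q)
          (Polynomial.aeval (∑ j : Fin 4, (MvPolynomial.X j : MvPolynomial (Fin 4) ℝ) ^ 2) R) *
          (c.eval (t ^ 2) + ∑ j, r j / (t ^ 2 + ω j ^ 2))) →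
    ∃ F : Polynomial ℝ, ∀ p : Fin 4 → ℝ, MvPolynomial.eval p (MvPolynomial.bind₁
      (fun i : Fin 4 => if i = 0 then ∑ j : Fin 4, (MvPolynomial.X j : MvPolynomial (Fin 4) ℝ) ^ 2
        else MvPolynomial.X i) E) = F.eval (∑ i, p i ^ 2) := by
  intro n
  induction n using Nat.strong_induction_on with
  | _ n ih =>
  intro E R hR hn hdeg hB4 hHalf hSt
  classical
  -- the axis-Stieltjes structure in the shell picture
  have hStE : ∀ q : Fin 3 → ℝ, q ≠ 0 → ∃ (k : ℕ) (ω r : Fin k → ℝ) (c : Polynomial ℝ),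
      (∀ j, 0 < ω j) ∧ (∀ j, 0 ≤ r j) ∧
      ∀ t : ℝ, MvPolynomial.eval (Fin.cons (t ^ 2 + ∑ i, q i ^ 2) q : Fin 4 → ℝ) E =
        R.eval (t ^ 2 + ∑ i, q i ^ 2) * (c.eval (t ^ 2) + ∑ j, r j / (t ^ 2 + ω j ^ 2)) := by
    intro q hq
    obtain ⟨k, ω, r, c, hω, hr, hid⟩ := hSt q hq
    refine ⟨k, ω, r, c, hω, hr, fun t => ?_⟩
    have h := hid t
    rwa [eval_cons_shell, eval_aeval_sumSq, sumSq_cons] at h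
  by_cases hbad : (∃ ρ : ℝ, R.eval ρ = 0 ∧ R.derivative.eval ρ = 0) ∨ (∃ z : ℂ, z.im ≠ 0 ∧ Polynomial.aeval z R = 0)
  · -- PEELING: a common radial factor `T`
    have hT : ∃ T : ℝ[X], T.Monic ∧ T ≠ 1 ∧ T ∣ R ∧
        ∀ q : Fin 3 → ℝ, q ≠ 0 → T ∣ Polynomial.map (MvPolynomial.eval q) (MvPolynomial.finSuccEquiv ℝ 3 E) := by
      rcases hbad with ⟨ρ, hρ, hρ'⟩ | ⟨z, hz, hzR⟩
      · refine ⟨Polynomial.X - Polynomial.C ρ, Polynomial.monic_X_sub_C ρ, ?_, Polynomial.dvd_iff_isRoot.2 hρ, ?_⟩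
        · intro h1
          have := congrArg Polynomial.natDegree h1
          rw [Polynomial.natDegree_X_sub_C, Polynomial.natDegree_one] at this
          exact one_ne_zero this
        · intro q hq
          obtain ⟨k, ω, r, c, -, hr, hid⟩ := hStE q hq
          obtain ⟨-, hrealroot⟩ := local_analysis E R c q ω r hr hid
          obtain ⟨rJ, -, hval⟩ := hrealroot ρ hρ
          rw [Polynomial.dvd_iff_isRoot, Polynomial.IsRoot.def, eval_fibre, hval, hρ', zero_mul]
      · obtain ⟨hmon, hdeg2⟩ := quadFactor_monic z
        refine ⟨_, hmon, ?_, quadFactor_dvd z hz R hzR, ?_⟩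
        · intro h1
          have := congrArg Polynomial.natDegree h1
          rw [hdeg2, Polynomial.natDegree_one] at this
          exact absurd this (by norm_num)
        · intro q hq
          obtain ⟨k, ω, r, c, -, hr, hid⟩ := hStE q hq
          obtain ⟨hcomplex, -⟩ := local_analysis E R c q ω r hr hid
          exact quadFactor_dvd z hz _ (hcomplex z hz hzR)
    obtain ⟨T, hTmon, hT1, hTR, hTE⟩ := hT
    obtain ⟨E₁, R₁, hR₁, hdegs, hdeg₁, hB4₁, hHalf₁, hSt₁, heval⟩ :=
      peel E R T hR hTmon hT1 hTR hTE hdeg hB4 hHalf hSt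
    have hTdeg : 0 < T.natDegree := by
      by_contra h0
      push Not at h0
      have h0' : T.natDegree = 0 := Nat.le_zero.1 h0
      exact hT1 (Polynomial.eq_one_of_monic_natDegree_zero hTmon h0')
    have hlt : R₁.natDegree < n := by omega
    obtain ⟨F₁, hF₁⟩ := ih R₁.natDegree hlt E₁ R₁ hR₁ rfl hdeg₁ hB4₁ hHalf₁ hSt₁
    refine ⟨T * F₁, fun p => ?_⟩
    rw [heval p, hF₁ p, Polynomial.eval_mul]
  · -- all roots real and simple
    push Not at hbad
    obtain ⟨hsimple, hreal⟩ := hbad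
    refine simple_shell_radial E R hR (fun z hz => ?_) (fun ρ hρ => hsimple ρ hρ) hdeg hB4 hHalf hStE
    by_contra him
    exact hreal z him hz

/-! ### 3. The stub -/

/-- **`stub_alternation`** (Step 4 of crux 23124; the birth skeleton's statement VERBATIM with `IsB4Inv`, `IsHalfInv`, `Radial`,
`AxisStieltjes`, `RadialRatio` unfolded): radial denominator + axis-Stieltjes + sub-curvature budget + `W(F₄)`-symmetry of the
numerator ⇒ the ratio is radial. [folklore] -/
theorem stub_alternation :
    ∀ N₀ D₀ : MvPolynomial (Fin 4) ℝ,
      (∀ (σ : Equiv.Perm (Fin 4)) (ε : Fin 4 → ℝ), (∀ i, ε i = 1 ∨ ε i = -1) →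
        ∀ p : Fin 4 → ℝ, MvPolynomial.eval (fun i => ε i * p (σ i)) N₀ = MvPolynomial.eval p N₀) →
      (∀ p : Fin 4 → ℝ, MvPolynomial.eval (fun i => p i - (∑ j, p j) / 2) N₀ = MvPolynomial.eval p N₀) →
      D₀ ≠ 0 →
      (∃ F : Polynomial ℝ, ∀ p : Fin 4 → ℝ, MvPolynomial.eval p D₀ = F.eval (∑ i, p i ^ 2)) →
      N₀.totalDegree ≤ D₀.totalDegree + 2 →
      (∀ q : Fin 3 → ℝ, q ≠ 0 → ∃ (k : ℕ) (ω r : Fin k → ℝ) (c : Polynomial ℝ),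
        (∀ j, 0 < ω j) ∧ (∀ j, 0 ≤ r j) ∧
        ∀ t : ℝ, MvPolynomial.eval (Fin.cons t q) N₀ =
          MvPolynomial.eval (Fin.cons t q) D₀ * (c.eval (t ^ 2) + ∑ j, r j / (t ^ 2 + ω j ^ 2))) →
      ∃ F G : Polynomial ℝ, G ≠ 0 ∧ ∀ p : Fin 4 → ℝ,
        MvPolynomial.eval p N₀ * G.eval (∑ i, p i ^ 2) = MvPolynomial.eval p D₀ * F.eval (∑ i, p i ^ 2) := by
  intro N₀ D₀ hB4 hHalf hD0 hRad hdeg hSt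
  classical
  obtain ⟨R, hR⟩ := hRad
  -- `D₀ = R(Σ Xᵢ²)` as polynomials, `R ≠ 0`
  have hD : D₀ = Polynomial.aeval (∑ j : Fin 4, (MvPolynomial.X j : MvPolynomial (Fin 4) ℝ) ^ 2) R := by
    apply MvPolynomial.funext
    intro p
    rw [hR p, eval_aeval_sumSq]
  have hRne : R ≠ 0 := by
    intro h
    apply hD0
    rw [hD, h, map_zero]
  -- the shell form of the even numerator
  have heven : ∀ p : Fin 4 → ℝ,
      MvPolynomial.eval (fun i => if i = 0 then -p 0 else p i) N₀ = MvPolynomial.eval p N₀ := by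
    intro p
    have h := hB4 (Equiv.refl _) (fun i => if i = 0 then (-1 : ℝ) else 1)
      (fun i => by by_cases hi : i = 0 <;> simp [hi]) p
    have hfun : (fun i : Fin 4 => (if i = 0 then (-1 : ℝ) else 1) * p ((Equiv.refl (Fin 4)) i)) =
        fun i => if i = 0 then -p 0 else p i := by
      funext i
      by_cases hi : i = 0
      · subst hi; simp
      · simp [hi]
    rw [hfun] at h
    exact h
  obtain ⟨E, hE⟩ := exists_shell_of_even N₀ heven
  -- budget
  have hdegE : (MvPolynomial.bind₁
      (fun i : Fin 4 => if i = 0 then ∑ j : Fin 4, (MvPolynomial.X j : MvPolynomial (Fin 4) ℝ) ^ 2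
        else MvPolynomial.X i) E).totalDegree ≤ 2 * R.natDegree + 2 := by
    rw [← hE]
    have := totalDegree_aeval_sumSq_le R
    rw [← hD] at this
    omega
  obtain ⟨F, hF⟩ := radial_main R.natDegree E R hRne rfl hdegE (by rw [← hE]; exact hB4) (by rw [← hE]; exact hHalf)
    (by
      intro q hq
      obtain ⟨k, ω, r, c, hω, hr, hid⟩ := hSt q hq
      refine ⟨k, ω, r, c, hω, hr, fun t => ?_⟩
      rw [← hE, ← hD]
      exact hid t)
  refine ⟨F, R, hRne, fun p => ?_⟩
  rw [← hE] at hF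
  rw [hF p, hR p, mul_comm]

end Summit.QuantumFields.YangMills.Theorems.RationalShortRootRigidity.Alternation
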